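import Mathlib
import HarnessLib
import Summits.HubbardSuperconductivity.HubbardSuperconductivity.Theorems.KLProgrammeSWaveCascadeArrayAllScales
import Summits.HubbardSuperconductivity.HubbardSuperconductivity.Theorems.KLProgrammeKLRegimeBetaSplitEdgeF

/-!
# Route `KLProgramme` — crux K3 gen 8, CHILD 1 (stmt-HubbardSuperconductivity-20438) in scheme F-II: row 0′ on the cross-frame carrier with the Riccati
# COMPARISON SEQUENCE EXPORTED AT ALL SCALES — `flowPairArray_envelope_edge_allScales` and the constants-chosen `pairArrayAllScales_of_edgeClauses_explicit`

Cell gate-hubbard-kl, seat hubbard-kl-k3c1-p1 (g19; child-1 lineage; technique «composed-map remainder propagation»).  Context: pen g25 (R366)(q-α2), (R367)(2)(k-1),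
(R368)(A) «S3 IN U-CURRENCY», (R372)(B) «CHILD1-ALLSCALES-EXPORT» (cell STATUS 2026-08-29T05:15–05:32Z): the exported child-1 predicate `PairArrayAtV17F … j`
(`…SplitSlotsV17F`) hands, at every scale `j` of the history separately, SOME `u ∈ [0, 2|U|]` within `(C_W + κ·CR·Klam³)·U²` of the pair amplitudes on the
bare ball — the comparison value is re-chosen per scale, so the history carries NO cross-scale link (monotonicity / total variation of the Cooper-ball values),
which is the input (k-1) the aniso `U`-currency line needs.  The PROOF of `pairArrayAtV17F_of_edgeClauses_explicit` (`…BetaSplitEdgeF`, over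
`flowPairArray_envelope_edge`, `…SplitFlowPairArrayEdge`) does construct that link: ONE Riccati comparison sequence per total momentum.  This file is the
model instance of the carrier-generic all-scales export `SWaveCascade.amplitudeArray_envelope_edge_allScales` (`…SWaveCascadeArrayAllScales`):

* §1 **`flowPairArray_envelope_edge_allScales`** — the hypotheses of `flowPairArray_envelope_edge` VERBATIM (proof adapted from that file; `gainBar ≥ 0` from
  `G.WF` supplies the one extra generic premise) ⟹ per `Qm`: `∃ Us W m : ℕ → ℝ`, `Us 0 = U`, `Us (i+1) = Us i/(1 + W i·Us i)`, `|W i| ≤ m i ≤ bhi`,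
  `m i − W i ≤ δ (i+1) Qm` at in-class steps `i < n`, `W i = m i = 0` past the class exit or past `n`, `16·U·Σ_{i<n}(m i − W i) ≤ 1`, and at EVERY `j ≤ n`:
  `0 ≤ Us j ≤ (16/15)·U` and `‖𝒞_j[K_j](Qm;k,k′) − Us j‖ ≤` the SAME number as `flowPairArray_envelope_edge` at scale `n`;
* §2 **`pairArrayAllScales_of_edgeClauses_explicit`** — the hypotheses of `pairArrayAtV17F_of_edgeClauses_explicit` VERBATIM (constants algebra adapted from that
  file) ⟹ per `Qm` ONE sequence `u` with the (B1-F) envelope `0 ≤ u j ≤ 2|U|`, `‖𝒞_j[K_j](Qm;k,k′) − u j‖ ≤ (C_W + κ·CR·Klam³)·U²` at EVERY `j ≤ n` (so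
  `PairArrayAtV17F … j` for all `j ≤ n` with a COMMON witness), the exact cascade law with its signed masses as in §1, the quasi-monotonicity
  `u j ≤ u i + (16U/15)²·Σ_{l∈[i,j)}(m l − W l)` (`i ≤ j ≤ n`) and the total variation `Σ_{i<n} |u (i+1) − u i| ≤ (257/225)·U` — `U`-currency.

No registered text and no landed file is touched (new helper, `--supports stmt-…-20437`).  Nothing here asserts that the model's amplitudes satisfy the hypotheses
(that is the engine's (E2-F2)/(E2″-F) output); nothing asserts superconductivity.  Everything is proved; no definitions.
-/

noncomputable section

namespace Summit.HubbardSuperconductivity.HubbardSuperconductivity.Theorems.KLRegimeSplit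

set_option linter.dupNamespace false -- summit = problem name (single-conjunct summit), D-0017

open Real Finset Literature.MathematicalPhysics.QuantumLattice Literature.Probability.LatticeModels
open Summit.HubbardSuperconductivity.HubbardSuperconductivity.Theorems.KLProgrammeLegKernels
open Summit.HubbardSuperconductivity.HubbardSuperconductivity.Theorems.CooperChannelRiccatiFlow
open Summit.HubbardSuperconductivity.HubbardSuperconductivity.Theorems.SWaveCascade

section Model

variable (L M : ℕ) [NeZero L] [NeZero M]

variable {G : GeoConsts} {P : SplitConsts} {Qc : EngConsts}

/-- **Row 0′ on the cross-frame carrier of scheme F-II, every total momentum — ALL-SCALES EXPORT.**  Hypotheses = those of `flowPairArray_envelope_edge`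
verbatim; conclusion = the export of `SWaveCascade.amplitudeArray_envelope_edge_allScales` for the amplitudes `klPairAmplitude … (klFlowFrameU … j) j Qm` on
`klBall L μ 0` with the class `IsPairClassAt L Qm`; see the module docstring. -/
theorem flowPairArray_envelope_edge_allScales (hG : G.WF) (hP : P.WF) (hQc : Qc.WF) {β U μ : ℝ} (hU : 0 ≤ U)
    {n : ℕ} (X : ℕ → TorusSite 2 L → TorusSite 2 L → TorusSite 2 L → ℝ) {Xtot Xsup : ℝ}
    (hX0 : ∀ j Qm k k', 0 ≤ X j Qm k k') (hXtot0 : 0 ≤ Xtot) (hXsup0 : 0 ≤ Xsup)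
    (hXsup : ∀ j Qm k k', X j Qm k k' ≤ Xsup)
    (hXsum : ∀ (t : ℕ) (Qm k k' : TorusSite 2 L), ∑ j ∈ Ioc t n, X j Qm k k' ≤ Xtot)
    (hXtot : ∀ Qm k k' : TorusSite 2 L, X 0 Qm k k' + ∑ i ∈ range n, X (i + 1) Qm k k' ≤ Xtot)
    (δ : ℕ → TorusSite 2 L → ℝ)
    (hneg : ∀ Qm : TorusSite 2 L, ∀ t ≤ n, IsPairClassAt L Qm t → 16 * U * ∑ i ∈ range t, δ (i + 1) Qm ≤ 1)
    (h0 : ∀ Qm : TorusSite 2 L, ∀ k ∈ klBall L μ 0, ∀ k' ∈ klBall L μ 0,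
      ‖klPairAmplitude L M β U μ (klFlowFrameU L M β U μ 0) 0 Qm k k' - (U : ℂ)‖ ≤ initDevBar G U + X 0 Qm k k')
    (hsteps : ∀ j, 1 ≤ j → j ≤ n → ∀ Qm : TorusSite 2 L, IsPairClassAt L Qm j →
      ∃ w : TorusSite 2 L → ℝ, (∑ p, |w p| ≤ G.bhi) ∧ (∑ p, (|w p| - w p) ≤ δ j Qm) ∧
        ∃ N : Matrix (TorusSite 2 L) (TorusSite 2 L) ℂ,
          (1 + Matrix.diagonal (fun p => (w p : ℂ)) * klPairArrayF L M β U μ (j - 1) Qm) * N = 1 ∧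
          ∀ k ∈ klBall L μ 0, ∀ k' ∈ klBall L μ 0,
            ‖klPairAmplitude L M β U μ (klFlowFrameU L M β U μ j) j Qm k k' - (klPairArrayF L M β U μ (j - 1) Qm * N) k k'‖ ≤
              drivePBar G P U (j - 1) + eremBar G P Qc U β L (j - 1) + X j Qm k k')
    (hincr : ∀ j, 1 ≤ j → j ≤ n → ∀ Qm : TorusSite 2 L, ∀ k ∈ klBall L μ 0, ∀ k' ∈ klBall L μ 0,
      ‖klPairAmplitude L M β U μ (klFlowFrameU L M β U μ j) j Qm k k' -
          klPairAmplitude L M β U μ (klFlowFrameU L M β U μ (j - 1)) (j - 1) Qm k k'‖ ≤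
        gainBar G P U j (klTorusNorm L Qm) (klTorusNorm L (k - k')) (klTorusNorm L (k + k' - Qm)) +
          eremBar G P Qc U β L (j - 1) + X j Qm k k')
    (Qm : TorusSite 2 L)
    (hsmall : 8 * 42 * ((initDevBar G U + ∑ j ∈ range n, (drivePBar G P U j + eremBar G P Qc U β L j) + Xtot) +
        (∑ j ∈ range n, (drivePBar G P U j + eremBar G P Qc U β L j) + Xsup)) * (G.bhi * n) ≤ 1) :
    ∃ Us W m : ℕ → ℝ, Us 0 = U ∧ (∀ i, Us (i + 1) = Us i / (1 + W i * Us i)) ∧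
      (∀ i, |W i| ≤ m i ∧ m i ≤ G.bhi) ∧
      (∀ i < n, IsPairClassAt L Qm (i + 1) → m i - W i ≤ δ (i + 1) Qm) ∧
      (∀ i, (n ≤ i ∨ ¬ IsPairClassAt L Qm (i + 1)) → W i = 0 ∧ m i = 0) ∧
      16 * U * ∑ i ∈ range n, (m i - W i) ≤ 1 ∧
      ∀ j ≤ n, 0 ≤ Us j ∧ Us j ≤ 16 / 15 * U ∧ ∀ k ∈ klBall L μ 0, ∀ k' ∈ klBall L μ 0,
        ‖klPairAmplitude L M β U μ (klFlowFrameU L M β U μ j) j Qm k k' - (Us j : ℂ)‖ ≤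
          12 * ((initDevBar G U + ∑ j ∈ range n, (drivePBar G P U j + eremBar G P Qc U β L j) + Xtot) +
            (∑ j ∈ range n, (drivePBar G P U j + eremBar G P Qc U β L j) + Xsup)) +
          ((P.Klam * U) ^ 2 * (3 * G.CF) + Xtot + ∑ i ∈ range n, eremBar G P Qc U β L i) := by
  classical
  have hG' := hG
  obtain ⟨-, -, -, -, -, -, -, -, -, -, -, hpp0, hph0, hCF, hphsum, hppsum, -⟩ := hG'
  have hbhi : 0 ≤ G.bhi := hG.2.2.1.trans hG.2.2.2.1
  have hinit0 : 0 ≤ initDevBar G U := by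
    unfold initDevBar
    refine mul_nonneg (add_nonneg (sum_nonneg fun χ _ => add_nonneg (hG.2.1 χ) (hG.1 χ)) zero_le_one) (sq_nonneg U)
  have hGtot0 : 0 ≤ (P.Klam * U) ^ 2 * (3 * G.CF) := by positivity
  -- the gain majorant is nonnegative
  have hgain0 : ∀ (j : ℕ) (k k' : TorusSite 2 L),
      0 ≤ gainBar G P U j (klTorusNorm L Qm) (klTorusNorm L (k - k')) (klTorusNorm L (k + k' - Qm)) := by
    intro j k k'
    unfold gainBar
    exact mul_nonneg (sq_nonneg _) (add_nonneg (add_nonneg (hpp0 _ _) (hph0 _ _)) (hph0 _ _))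
  -- the frozen-gain line past the class exit, from `G.WF`'s gain sums
  have hg : ∀ t ≤ n, ¬ IsPairClassAt L Qm (t + 1) → ∀ k ∈ klBall L μ 0, ∀ k' ∈ klBall L μ 0,
      ∑ j ∈ Ioc t n, gainBar G P U j (klTorusNorm L Qm) (klTorusNorm L (k - k')) (klTorusNorm L (k + k' - Qm)) ≤
        (P.Klam * U) ^ 2 * (3 * G.CF) := by
    intro t _ hexit k _ k' _
    have hexit' : ((4 : ℝ) ^ (t + 1))⁻¹ < klTorusNorm L Qm := lt_of_not_ge hexit
    have h1 : ∑ j ∈ Ioc t n, G.ppGain j (klTorusNorm L Qm) ≤ G.CF := hppsum _ t n hexit'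
    have hsub : ∀ ρ : ℝ, ∑ j ∈ Ioc t n, G.phGain j ρ ≤ ∑ j ∈ range (n + 1), G.phGain j ρ := fun ρ =>
      sum_le_sum_of_subset_of_nonneg (fun j hj => by simp only [mem_Ioc] at hj; exact mem_range.2 (by omega)) fun j _ _ => hph0 j ρ
    have h2 : ∑ j ∈ Ioc t n, G.phGain j (klTorusNorm L (k - k')) ≤ G.CF :=
      (hsub _).trans (hphsum _ (n + 1) (torusSupNorm_nonneg _))
    have h3 : ∑ j ∈ Ioc t n, G.phGain j (klTorusNorm L (k + k' - Qm)) ≤ G.CF :=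
      (hsub _).trans (hphsum _ (n + 1) (torusSupNorm_nonneg _))
    simp only [gainBar, ← mul_sum, sum_add_distrib]
    nlinarith [h1, h2, h3, sq_nonneg (P.Klam * U)]
  exact amplitudeArray_envelope_edge_allScales (klBall L μ 0) (fun j => klPairAmplitude L M β U μ (klFlowFrameU L M β U μ j) j Qm)
    (IsPairClassAt L Qm) (fun h hjm => isPairClassAt_mono L h hjm) hU hbhi hinit0 hGtot0
    (fun j => drivePBar G P U j + eremBar G P Qc U β L j) (fun j => eremBar G P Qc U β L j)
    (fun j => add_nonneg (drivePBar_nonneg' hG U j) (eremBar_nonneg' hG hP hQc U β L j))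
    (fun j => eremBar_nonneg' hG hP hQc U β L j)
    (fun j k k' => gainBar G P U j (klTorusNorm L Qm) (klTorusNorm L (k - k')) (klTorusNorm L (k + k' - Qm)))
    (fun j => X j Qm) hgain0 (fun j k k' => hX0 j Qm k k') hXtot0 hXsup0 (fun j k k' => hXsup j Qm k k') (fun t k k' => hXsum t Qm k k')
    (fun k k' => hXtot Qm k k') (fun j => δ j Qm) (hneg Qm) (h0 Qm)
    (fun j hj1 hjn hQj => hsteps j hj1 hjn Qm hQj) (fun j hj1 hjn k hk k' hk' => hincr j hj1 hjn Qm k hk k' hk') hg hsmall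

set_option maxHeartbeats 400000 in -- polynomial bookkeeping (`nlinarith`/`linarith` on ~10 atoms), as in `pairArrayAtV17F_of_edgeClauses_explicit`
/-- **Row 0′ with the constants chosen, on the cross-frame carrier of scheme F-II — ALL-SCALES EXPORT** (twin of `pairArrayAtV17F_of_edgeClauses_explicit`, SAME
hypotheses).  Conclusion, per total momentum `Qm`: ONE sequence `u : ℕ → ℝ` with its signed cascade masses `W`, `m` such that
(i) `u 0 = U`, `u (i+1) = u i/(1 + W i·u i)`, `|W i| ≤ m i ≤ bhi`; (ii) `m i − W i ≤ δ (i+1) Qm` at every in-class step `i < n`; (iii) `W i = m i = 0` past the class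
exit or past `n`; (iv) the negative-mass line `16·U·Σ_{i<n}(m i − W i) ≤ 1`; (v) QUASI-MONOTONICITY `u j ≤ u i + (16U/15)²·Σ_{l∈[i,j)}(m l − W l)` for
`i ≤ j ≤ n`; (vi) TOTAL VARIATION `Σ_{i<n} |u (i+1) − u i| ≤ (257/225)·U`; (vii) at EVERY `j ≤ n` the (B1-F) envelope `0 ≤ u j ≤ 2|U|`,
`‖𝒞_j[K_j](Qm;k,k′) − u j‖ ≤ (C_W + klLegKappa·CR·Klam³)·U²` on `klBall L μ 0` — i.e. `PairArrayAtV17F … j` for all `j ≤ n` with a COMMON, cross-scale-linked witness. -/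
theorem pairArrayAllScales_of_edgeClauses_explicit (hG : G.WF) (hP : P.WF) (hQc : Qc.WF) {β U μ : ℝ} (hU : 0 ≤ U) {n : ℕ} {sG sQ tG tQ : ℝ}
    (hsG : 0 ≤ sG) (hsQ : 0 ≤ sQ) (htG : 0 ≤ tG) (htQ : 0 ≤ tQ)
    (hκ : 12 * (tQ + sQ) + tQ ≤ klLegKappa)
    (X : ℕ → TorusSite 2 L → TorusSite 2 L → TorusSite 2 L → ℝ) (hX0 : ∀ j Qm k k', 0 ≤ X j Qm k k')
    (hXsup : ∀ j Qm k k', X j Qm k k' ≤ sG * (G.CF * (P.Klam * U) ^ 2) + sQ * (Qc.CR * P.Klam ^ 3 * U ^ 2))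
    (hXsum : ∀ (t : ℕ) (Qm k k' : TorusSite 2 L),
      ∑ j ∈ Ioc t n, X j Qm k k' ≤ tG * (G.CF * (P.Klam * U) ^ 2) + tQ * (Qc.CR * P.Klam ^ 3 * U ^ 2))
    (hXtot : ∀ Qm k k' : TorusSite 2 L,
      X 0 Qm k k' + ∑ i ∈ range n, X (i + 1) Qm k k' ≤ tG * (G.CF * (P.Klam * U) ^ 2) + tQ * (Qc.CR * P.Klam ^ 3 * U ^ 2))
    (δ : ℕ → TorusSite 2 L → ℝ)
    (hneg : ∀ Qm : TorusSite 2 L, ∀ t ≤ n, IsPairClassAt L Qm t → 16 * U * ∑ i ∈ range t, δ (i + 1) Qm ≤ 1)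
    (h0 : ∀ Qm : TorusSite 2 L, ∀ k ∈ klBall L μ 0, ∀ k' ∈ klBall L μ 0,
      ‖klPairAmplitude L M β U μ (klFlowFrameU L M β U μ 0) 0 Qm k k' - (U : ℂ)‖ ≤ initDevBar G U + X 0 Qm k k')
    (hsteps : ∀ j, 1 ≤ j → j ≤ n → ∀ Qm : TorusSite 2 L, IsPairClassAt L Qm j →
      ∃ w : TorusSite 2 L → ℝ, (∑ p, |w p| ≤ G.bhi) ∧ (∑ p, (|w p| - w p) ≤ δ j Qm) ∧
        ∃ N : Matrix (TorusSite 2 L) (TorusSite 2 L) ℂ,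
          (1 + Matrix.diagonal (fun p => (w p : ℂ)) * klPairArrayF L M β U μ (j - 1) Qm) * N = 1 ∧
          ∀ k ∈ klBall L μ 0, ∀ k' ∈ klBall L μ 0,
            ‖klPairAmplitude L M β U μ (klFlowFrameU L M β U μ j) j Qm k k' - (klPairArrayF L M β U μ (j - 1) Qm * N) k k'‖ ≤
              drivePBar G P U (j - 1) + eremBar G P Qc U β L (j - 1) + X j Qm k k')
    (hincr : ∀ j, 1 ≤ j → j ≤ n → ∀ Qm : TorusSite 2 L, ∀ k ∈ klBall L μ 0, ∀ k' ∈ klBall L μ 0,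
      ‖klPairAmplitude L M β U μ (klFlowFrameU L M β U μ j) j Qm k k' - klPairAmplitude L M β U μ (klFlowFrameU L M β U μ (j - 1)) (j - 1) Qm k k'‖ ≤
        gainBar G P U j (klTorusNorm L Qm) (klTorusNorm L (k - k')) (klTorusNorm L (k + k' - Qm)) +
          eremBar G P Qc U β L (j - 1) + X j Qm k k')
    (hUCR : 2 * Qc.CR * P.Klam ^ 3 * |U| ≤ 1) (hL : 17 * ∑ j ∈ range n, Qc.CL β j / L ≤ U ^ 2)
    (hsmall : 8 * 42 * (((∑ χ : D4Irrep, (G.abot χ + G.atop χ) + 1) +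
        2 * (G.aplus * P.Klam ^ 2 * G.Z + G.cloc * P.Klam ^ 2 * (1 - (4 : ℝ) ^ (-G.θ))⁻¹ + 1) + 1 +
          (tG + sG) * (G.CF * P.Klam ^ 2) + (tQ + sQ) * (Qc.CR * P.Klam ^ 3)) * U ^ 2) * (G.bhi * n) ≤ 1)
    (hCW : 12 * (∑ χ : D4Irrep, (G.abot χ + G.atop χ) + 1) +
        25 * (G.aplus * P.Klam ^ 2 * G.Z + G.cloc * P.Klam ^ 2 * (1 - (4 : ℝ) ^ (-G.θ))⁻¹ + 1) + 2 +
          (12 * (tG + sG) + 3 + tG) * (G.CF * P.Klam ^ 2) ≤ P.C_W) :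
    ∀ Qm : TorusSite 2 L, ∃ u W m : ℕ → ℝ, u 0 = U ∧ (∀ i, u (i + 1) = u i / (1 + W i * u i)) ∧
      (∀ i, |W i| ≤ m i ∧ m i ≤ G.bhi) ∧
      (∀ i < n, IsPairClassAt L Qm (i + 1) → m i - W i ≤ δ (i + 1) Qm) ∧
      (∀ i, (n ≤ i ∨ ¬ IsPairClassAt L Qm (i + 1)) → W i = 0 ∧ m i = 0) ∧
      16 * U * ∑ i ∈ range n, (m i - W i) ≤ 1 ∧
      (∀ i j, i ≤ j → j ≤ n → u j ≤ u i + (16 / 15 * U) ^ 2 * ∑ l ∈ Ico i j, (m l - W l)) ∧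
      ∑ i ∈ range n, |u (i + 1) - u i| ≤ 257 / 225 * U ∧
      ∀ j ≤ n, 0 ≤ u j ∧ u j ≤ 2 * |U| ∧ ∀ k ∈ klBall L μ 0, ∀ k' ∈ klBall L μ 0,
        ‖klPairAmplitude L M β U μ (klFlowFrameU L M β U μ j) j Qm k k' - (u j : ℂ)‖ ≤
          (P.C_W + klLegKappa * Qc.CR * P.Klam ^ 3) * U ^ 2 := by
  have hdrive := drivePBar_sum_le (P := P) hG U n
  have herem := eremBar_sum_le hG hP hQc U β L n
  have hU2 : 0 ≤ U ^ 2 := sq_nonneg U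
  have hCL0 : 0 ≤ ∑ j ∈ range n, Qc.CL β j / L := sum_nonneg fun j _ => div_nonneg (hQc.2.2.2.2.2.2.2 β j) (Nat.cast_nonneg L)
  have hθ : 0 < G.θ := hG.2.2.2.2.2.1
  have hg : 0 ≤ (1 - (4 : ℝ) ^ (-G.θ))⁻¹ :=
    inv_nonneg.2 (by have := Real.rpow_lt_one_of_one_lt_of_neg (x := (4 : ℝ)) (by norm_num) (by linarith : -G.θ < 0); linarith)
  have hK0 : 0 ≤ P.Klam := zero_le_one.trans hP.1
  have hcloc : 0 ≤ G.cloc := hG.2.2.2.2.1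
  have haplus : 0 ≤ G.aplus := hG.2.2.2.2.2.2.2.2.2.2.1
  have hCF : 0 ≤ G.CF := hG.2.2.2.2.2.2.2.2.2.2.2.2.2.1
  have hCR : 0 ≤ Qc.CR := hQc.2.1
  have hbhi : 0 ≤ G.bhi := hG.2.2.1.trans hG.2.2.2.1
  have hab : 0 ≤ ∑ χ : D4Irrep, (G.abot χ + G.atop χ) := sum_nonneg fun χ _ => add_nonneg (hG.2.1 χ) (hG.1 χ)
  have hZ : 0 ≤ G.Z := le_trans (sum_nonneg fun j _ => hG.2.2.2.2.2.2.2.2.1 j) (hG.2.2.2.2.2.2.2.2.2.1 0)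
  -- the two quadratic units `g2 = CF·(Klam U)²`, `q3 = CR·Klam³·U²` and the product facts `linarith` needs
  have hg20 : 0 ≤ G.CF * (P.Klam * U) ^ 2 := by positivity
  have hq30 : 0 ≤ Qc.CR * P.Klam ^ 3 * U ^ 2 := by positivity
  have hsq : G.CF * (P.Klam * U) ^ 2 = (G.CF * P.Klam ^ 2) * U ^ 2 := by ring
  have hCRU : 2 * Qc.CR * P.Klam ^ 3 * |U| * U ^ 2 ≤ U ^ 2 := by nlinarith
  have hS : ∑ j ∈ range n, (drivePBar G P U j + eremBar G P Qc U β L j) ≤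
      (G.aplus * P.Klam ^ 2 * G.Z + G.cloc * P.Klam ^ 2 * (1 - (4 : ℝ) ^ (-G.θ))⁻¹) * U ^ 2 +
        2 * Qc.CR * P.Klam ^ 3 * |U| * U ^ 2 + ∑ j ∈ range n, Qc.CL β j / L := by
    rw [sum_add_distrib]; nlinarith [hdrive, herem]
  have hS0 : 0 ≤ ∑ j ∈ range n, (drivePBar G P U j + eremBar G P Qc U β L j) :=
    sum_nonneg fun j _ => add_nonneg (drivePBar_nonneg' hG U j) (eremBar_nonneg' hG hP hQc U β L j)
  have hinit : initDevBar G U = (∑ χ : D4Irrep, (G.abot χ + G.atop χ) + 1) * U ^ 2 := rfl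
  have hn0 : (0 : ℝ) ≤ n := Nat.cast_nonneg n
  have hSe0 : 0 ≤ ∑ i ∈ range n, eremBar G P Qc U β L i := sum_nonneg fun i _ => eremBar_nonneg' hG hP hQc U β L i
  have haKZU : 0 ≤ G.aplus * P.Klam ^ 2 * G.Z * U ^ 2 := by positivity
  have hcKgU : 0 ≤ G.cloc * P.Klam ^ 2 * (1 - (4 : ℝ) ^ (-G.θ))⁻¹ * U ^ 2 := by positivity
  have hXtot0 : 0 ≤ tG * (G.CF * (P.Klam * U) ^ 2) + tQ * (Qc.CR * P.Klam ^ 3 * U ^ 2) := by positivity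
  have hXsup0 : 0 ≤ sG * (G.CF * (P.Klam * U) ^ 2) + sQ * (Qc.CR * P.Klam ^ 3 * U ^ 2) := by positivity
  -- the no-onset line
  have hsm : 8 * 42 * ((initDevBar G U + ∑ j ∈ range n, (drivePBar G P U j + eremBar G P Qc U β L j) +
          (tG * (G.CF * (P.Klam * U) ^ 2) + tQ * (Qc.CR * P.Klam ^ 3 * U ^ 2))) +
        (∑ j ∈ range n, (drivePBar G P U j + eremBar G P Qc U β L j) +
          (sG * (G.CF * (P.Klam * U) ^ 2) + sQ * (Qc.CR * P.Klam ^ 3 * U ^ 2)))) * (G.bhi * n) ≤ 1 := by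
    refine le_trans ?_ hsmall
    have hmain : (initDevBar G U + ∑ j ∈ range n, (drivePBar G P U j + eremBar G P Qc U β L j) +
          (tG * (G.CF * (P.Klam * U) ^ 2) + tQ * (Qc.CR * P.Klam ^ 3 * U ^ 2))) +
        (∑ j ∈ range n, (drivePBar G P U j + eremBar G P Qc U β L j) +
          (sG * (G.CF * (P.Klam * U) ^ 2) + sQ * (Qc.CR * P.Klam ^ 3 * U ^ 2))) ≤
        ((∑ χ : D4Irrep, (G.abot χ + G.atop χ) + 1) +
          2 * (G.aplus * P.Klam ^ 2 * G.Z + G.cloc * P.Klam ^ 2 * (1 - (4 : ℝ) ^ (-G.θ))⁻¹ + 1) + 1 +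
            (tG + sG) * (G.CF * P.Klam ^ 2) + (tQ + sQ) * (Qc.CR * P.Klam ^ 3)) * U ^ 2 := by
      rw [hinit]
      linarith [hS, hCRU, hL, hCL0, hsq, hU2]
    have h0' : 0 ≤ (initDevBar G U + ∑ j ∈ range n, (drivePBar G P U j + eremBar G P Qc U β L j) +
          (tG * (G.CF * (P.Klam * U) ^ 2) + tQ * (Qc.CR * P.Klam ^ 3 * U ^ 2))) +
        (∑ j ∈ range n, (drivePBar G P U j + eremBar G P Qc U β L j) +
          (sG * (G.CF * (P.Klam * U) ^ 2) + sQ * (Qc.CR * P.Klam ^ 3 * U ^ 2))) := by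
      rw [hinit]; positivity
    exact mul_le_mul_of_nonneg_right (mul_le_mul_of_nonneg_left hmain (by norm_num)) (mul_nonneg hbhi hn0)
  -- the tolerance line: `24·S + Σē ≤ (25(aKZ + cKg) + 27)·U²`, the `g2`/`q3` numerals, `C_W`, `klLegKappa`
  have herem' : ∑ i ∈ range n, eremBar G P Qc U β L i ≤
      G.cloc * P.Klam ^ 2 * (1 - (4 : ℝ) ^ (-G.θ))⁻¹ * U ^ 2 + 2 * Qc.CR * P.Klam ^ 3 * |U| * U ^ 2 +
        ∑ j ∈ range n, Qc.CL β j / L := by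
    have := herem; linarith
  have hT1 : 24 * ∑ j ∈ range n, (drivePBar G P U j + eremBar G P Qc U β L j) + ∑ i ∈ range n, eremBar G P Qc U β L i ≤
      25 * (G.aplus * P.Klam ^ 2 * G.Z * U ^ 2 + G.cloc * P.Klam ^ 2 * (1 - (4 : ℝ) ^ (-G.θ))⁻¹ * U ^ 2) + 27 * U ^ 2 := by
    linarith [hS, herem', hCRU, hL, hCL0, haKZU]
  have hCWU := mul_le_mul_of_nonneg_right hCW hU2
  have hκq : (12 * (tQ + sQ) + tQ) * (Qc.CR * P.Klam ^ 3 * U ^ 2) ≤ klLegKappa * (Qc.CR * P.Klam ^ 3 * U ^ 2) :=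
    mul_le_mul_of_nonneg_right hκ hq30
  intro Qm
  obtain ⟨u, W, m, hu0, hlaw, hWm, hdef, hzero, hnegm, hu⟩ := flowPairArray_envelope_edge_allScales L M hG hP hQc hU X
    (Xtot := tG * (G.CF * (P.Klam * U) ^ 2) + tQ * (Qc.CR * P.Klam ^ 3 * U ^ 2))
    (Xsup := sG * (G.CF * (P.Klam * U) ^ 2) + sQ * (Qc.CR * P.Klam ^ 3 * U ^ 2)) hX0 hXtot0 hXsup0
    hXsup hXsum hXtot δ hneg h0 hsteps hincr Qm hsm
  -- the scalar consequences: quasi-monotonicity and total variation, with `ν i := m i − W i`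
  have hu0' : 0 ≤ u 0 := by rw [hu0]; exact hU
  have hWν : ∀ i, -(m i - W i) ≤ W i := fun i => by linarith [(hWm i).1, abs_nonneg (W i)]
  have hν0 : ∀ i, 0 ≤ m i - W i := fun i => by linarith [(hWm i).1, le_abs_self (W i)]
  have hnegm' : 16 * u 0 * ∑ i ∈ range n, (m i - W i) ≤ 1 := by rw [hu0]; exact hnegm
  have hqm := sWaveFloor_le_add_sum (U := u) (W := W) (ν := fun i => m i - W i) (N := n) hu0' hlaw hWν hν0 hnegm'
  have htv := sWaveFloor_totalVariation_le' (U := u) (W := W) (ν := fun i => m i - W i) (N := n) hu0' hlaw hWν hν0 hnegm'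
  rw [hu0] at hqm htv
  refine ⟨u, W, m, hu0, hlaw, hWm, hdef, hzero, hnegm, hqm, htv, fun j hjn => ?_⟩
  obtain ⟨huj0, hujU, hd⟩ := hu j hjn
  refine ⟨huj0, hujU.trans (by rw [abs_of_nonneg hU]; linarith), fun k hk k' hk' => (hd k hk k' hk').trans ?_⟩
  rw [hinit]
  linarith [hT1, hCWU, hκq, hq30, hg20, hS0, hSe0, hsq]

end Model

end Summit.HubbardSuperconductivity.HubbardSuperconductivity.Theorems.KLRegimeSplit

end
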